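import Literature.AlgebraicGeometry.Motives.MumfordTateGroupOfOrientationSerreGroupLevel
import Literature.AlgebraicGeometry.Motives.ZarhinHodgeGroupAutC
import HarnessLib

/-!
# WHICH LEVELS `S^E` map onto `MT(V_Π) = T^λ`: `λ̄_θ ∈ X^*(S^E)` iff `Gal(ℚ^{cm}/E)` stabilises the type of `Π`; for a CM type `Φ` this is
# «iff `Gal(ℚ^{cm}/E)` fixes the Hodge cocharacter `μ_Φ`» iff «`E` contains the reflex field `E*(K,Φ)`»
# (Milne–Shih, LNM 900 III §1 (1.3)–(1.6): `L ⊃` the field of definition of `μ`; Milne, *CM* I §1 Prop. 1.16–1.18, §4 Prop. 4.21; Shimura §8.3 Prop. 28)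

[topic AlgebraicGeometry/Motives]

Layer `Literature/AlgebraicGeometry/Motives`, lane `lit-hodgefound` (Track 2 foundations library; seat `lit-hodgefound-p02`, gen 32, row g32-#11).
THEOREMS ONLY (no definition, no named fact; D-0026 net debt `0`).  Complements g32-#10 (`Motives/MumfordTateGroupOfOrientationSerreGroupLevel`:
`ρ_Π` factors through ANY level `E` with `λ̄_{θ₁} ∈ Λ^E`, and such levels exist) by saying exactly WHICH levels qualify.  Uses g31-#2
(`Motives/MumfordTateGroupOfOrientationSerreGroupCharacters`: `mtCharCM_galRestrict`, `mtCharCM_mem_infinityTypesCM`; `mtChar_apply`: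
`λ_θ(τ) = p_Π(τ⁻¹θ)`), p27 (`SerreGroupLimitPoints.lambdaLevel E = Λ^E = X^*(S^E)`, `CMNumbers.galRestrict_surjective`), pub-hodgecm2
(`Motives/HodgeCocharacterOfCMTypeGaloisConjugate`: `forall_rTensor_aut_hodgeCocharacter_ofCMType_eq_iff_forall_smul_mem_iff`; `ComplexReflexFieldStabilizer`:
`forall_smul_mem_iff_iff_forall_apply_traceField_eq` — Shimura's Prop. 28), the tree's `Complex.mem_subfield_of_forall_ringEquiv` (the fixed
field of `Aut(ℂ/F)` is `F` for countable `F`) and `ZarhinLie.exists_ringEquiv_complex_comp_eq` (`Aut(ℂ)` is transitive on `Hom(K,ℂ)`).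

THE PRINTS.  J. S. Milne, K.-y. Shih [MilneShih1982Taniyama] III §1 (held text `book:deligne1982-hodge-cycles-motives-shimura-varieties`
pp. 164–165): (1.3) p. 231 «Let `T` be a `ℚ`-rational torus split over `L`, and `μ` a cocharacter … [then] `ρ_μ : S^L → T`»; (1.5)
p. 232 «`(T,μ)` … with `μ` defined over `L`»; (1.6) p. 232 «`λ ∈ X^*(S^L)` … `T^λ` the quotient of `S^L`».  J. S. Milne, *Complex
Multiplication* (2006) [MilneCM2006] Ch. I §1 Prop. 1.16, Def. 1.17 («the reflex field `E*` of `(E,Φ)` is the fixed field of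
`{σ | σΦ = Φ}`»), Prop. 1.18, §4 Prop. 4.21.  G. Shimura, *Abelian Varieties with Complex Multiplication* (1998) [Shimura1998] §8.3 Prop. 28
(`K* = ℚ(Σ ξ^{φᵢ})`, `H* = {γ | γS* = S*}`).  M. Kerr in [CattaniElZeinGriffithsLe2014] Ch. 12 §12.5.A Ex. 12.5.2 (a) («the field of definition
of `μ` is the reflex field»).

THE MECHANISM.  `λ̄_θ(ḡ) = p_Π(g⁻¹θ)` for any lift `g ∈ Aut(ℂ)` of `ḡ ∈ Gal(ℚ^{cm}/ℚ)` (g31-#2).  Right-invariance of `λ̄_θ` under `Gal(ℚ^{cm}/E)`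
reads `p_Π(κ⁻¹g⁻¹θ) = p_Π(g⁻¹θ)` for all `g` and all lifts `κ` of elements of `Gal(ℚ^{cm}/E)`; since `g⁻¹θ` runs through ALL embeddings
`K → ℂ` (transitivity of `Aut(ℂ)`), this says that the lifts of `Gal(ℚ^{cm}/E)` STABILISE the type `p_Π : Hom(K,ℂ) → ℤ` — a condition
independent of `θ`, so it is also the condition for the whole `Γ`-module `X^*(T^λ) = galSpan(λ̄_{θ₁})` to lie in `Λ^E` (§1).  For `Π =
Π(Φ)` a CM type, stabilising the `{0,1}`-valued type is `τΦ = Φ`, which pub-hodgecm2 identified with «`τ` fixes `μ_Φ`» and (Shimura's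
Prop. 28) with «`τ` fixes `E*(K,Φ) = ℚ(tr_Φ)` pointwise»; as `Aut(ℂ/E)` has fixed field `E` (countable), the latter is `E*(K,Φ) ⊆ E` (§2).

WHAT IS PROVED (`Λ : Orientation F n` polarizable, `E ⊂ ℚ^{cm}` any intermediate field; `IntermediateField.lift E` is `E` viewed in `ℂ`).
* §1 `galRestrict_mem_fixingSubgroup_iff` (`g| ∈ Gal(ℚ^{cm}/E) ⟺ g` fixes `E ⊂ ℂ` pointwise),
  **`mtCharCM_mem_lambdaLevel_iff`** (`λ̄_θ ∈ Λ^E ⟺` every `g ∈ Aut(ℂ)` fixing `E` stabilises the type: `p_Π(gθ′) = p_Π(θ′)` for all `θ′`),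
  `mtCharCM_mem_lambdaLevel_iff_of` (independent of `θ`), **`galSpan_mtCharCM_le_lambdaLevel_iff`** (`X^*(T^λ) ⊆ X^*(S^E)`, i.e. `T^λ = MT(V_Π)` is
  a quotient of `S^E`, iff the same).
* §2 (`Φ` a CM type of `F`) `forall_deg_ofCMType_smul_eq_iff` (stabilising `p_{Π(Φ)}` is `gΦ = Φ`),
  **`mtCharCM_ofCMType_mem_lambdaLevel_iff_forall_rTensor_aut_hodgeCocharacter`** (`λ̄ ∈ Λ^E ⟺ Aut(ℂ/E)` fixes `μ_Φ`: «`μ` defined over `L`»),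
  **`mtCharCM_ofCMType_mem_lambdaLevel_iff_traceField_le`** (`⟺ E*(F,Φ) ⊆ E`),
  **`galSpan_mtCharCM_ofCMType_le_lambdaLevel_iff_traceField_le`** (`MT(V¹_{(F,Φ)}) = T^λ` is a quotient of `S^E ⟺ E ⊇ E*(F,Φ)`),
  `exists_serreToGLLevel_of_traceField_le` (so for every such `E`, g32-#10's `ρ^E_Π` exists with `ρ^E_Π ∘ toLevel = ρ_Π`, onto `MT(ℂ)`, `ρ^E_Π ∘ μ^E = μ_Π`).

HONEST SCOPE.  Orientations of number fields `F : Type`; the reflex field enters only for CM TYPES, as Shimura's `traceField Φ ⊂ ℂ` (the tree's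
avatar of `E*(F,Φ)`); that `E*(F,Φ) ⊂ ℚ^{cm}` (so that `E = E*` itself is an admissible level) is not re-proved here; points/characters only.

## References
* [MilneShih1982Taniyama] J. S. Milne, K.-y. Shih, *Langlands's construction of the Taniyama group*, in LNM 900 (1982), art. III §1 (1.3),
  (1.5), (1.6) pp. 231–232 (held text pp. 164–165).
* [MilneCM2006] J. S. Milne, *Complex Multiplication* (course notes, 2006), Ch. I §1 Prop. 1.16, Def. 1.17, Prop. 1.18; §4 Prop. 4.21.
* [Shimura1998] G. Shimura, *Abelian Varieties with Complex Multiplication and Modular Functions*, Princeton UP (1998), §8.3 Prop. 28.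
* [CattaniElZeinGriffithsLe2014] E. Cattani, F. El Zein, P. Griffiths, Lê D. T. (eds.), *Hodge Theory*, Princeton UP (2014), Ch. 12 (M. Kerr)
  §12.5.A Examples 12.5.2 (a).

## Provenance
Lane `lit-hodgefound` (Hodge path, Track 2), prover seat `lit-hodgefound-p02` (generation 32), self-proposed row g32-#11 (which finite levels carry
`ρ_Π`; complements g32-#10).
-/

noncomputable section

open scoped TensorProduct Classical
open Module NumberField Cardinal

namespace Literature.AlgebraicGeometry.Motives

namespace HodgeStructure

namespace Orientation

open Literature.NumberTheory.ComplexMultiplication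
open Literature.NumberTheory.ComplexMultiplication.CMNumbers
open Literature.NumberTheory.NumberFields (cmNumbers cmNumbersConj cardinalMk_cmNumbers_le_aleph0)

variable {K : Type} [Field K] [NumberField K] {n : ℤ} (Λ : Orientation K n)

/-! ### §1 `λ̄_θ ∈ Λ^E` iff `Aut(ℂ/E)` stabilises the type of `Π` -/

omit Λ in
/-- `Aut(ℂ)` is transitive on `Hom(F, ℂ)` (the tree's `ZarhinLie.exists_ringEquiv_complex_comp_eq`). [folklore] -/
private theorem exists_ringEquiv_smul_eq_emb (θ θ' : K →+* ℂ) : ∃ τ : ℂ ≃+* ℂ, τ • θ = θ' := by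
  haveI : Countable K := Countable.of_equiv _ (Module.finBasis ℚ K).equivFun.toEquiv.symm
  obtain ⟨τ, hτ⟩ := ZarhinLie.exists_ringEquiv_complex_comp_eq θ θ'
  exact ⟨τ, RingHom.ext fun x => by rw [ringEquiv_smul_apply, hτ]⟩

omit Λ in
/-- **`g|ℚ^{cm} ∈ Gal(ℚ^{cm}/E)` iff `g` fixes `E ⊂ ℂ` pointwise** (`E` viewed in `ℂ` through `ℚ^{cm} ⊂ ℂ`, Mathlib's `IntermediateField.lift`).
[cite: MilneCM2006, Ch. I §1 Rem. 1.6 (p. 10)] -/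
theorem galRestrict_mem_fixingSubgroup_iff (g : ℂ ≃+* ℂ) (E : IntermediateField ℚ cmNumbers) :
    CMNumbers.galRestrict g ∈ E.fixingSubgroup ↔ ∀ x : ℂ, x ∈ IntermediateField.lift E → g x = x := by
  rw [IntermediateField.mem_fixingSubgroup_iff]
  constructor
  · rintro h x ⟨y, hy, rfl⟩
    exact (CMNumbers.coe_galRestrict_apply g y).symm.trans (congrArg Subtype.val (h y hy))
  · intro h y hy
    exact Subtype.ext ((CMNumbers.coe_galRestrict_apply g y).trans (h _ ⟨y, hy, rfl⟩))

/-- **`λ̄_θ ∈ Λ^E = X^*(S^E)` iff the automorphisms of `ℂ` over `E` STABILISE THE TYPE of `Π`**: `p_Π(gθ′) = p_Π(θ′)` for every `θ′ : F → ℂ`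
and every `g ∈ Aut(ℂ)` with `g|ℚ^{cm} ∈ Gal(ℚ^{cm}/E)` — the character `λ̄_θ` of `S` comes from the finite level `S^E` exactly when `E`
contains the field of definition of the type (`λ̄_θ(ḡ) = p_Π(g⁻¹θ)`, g31-#2; `Aut(ℂ)` transitive on `Hom(F,ℂ)`).
[cite: MilneShih1982Taniyama, III §1 (1.3) (p. 231), (1.5)–(1.6) (p. 232)] [cite: MilneCM2006, Ch. I §4 Prop. 4.21, p. 40] -/
theorem mtCharCM_mem_lambdaLevel_iff (hpol : (ofOrientation Λ).IsPolarizable) (θ : K →+* ℂ) (E : IntermediateField ℚ cmNumbers) :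
    Λ.mtCharCM θ ∈ lambdaLevel E ↔
      ∀ g : ℂ ≃+* ℂ, CMNumbers.galRestrict g ∈ E.fixingSubgroup → ∀ θ' : K →+* ℂ, Λ.deg (g • θ') = Λ.deg θ' := by
  rw [mem_lambdaLevel_iff]
  constructor
  · rintro ⟨-, h⟩ g hg θ'
    -- choose `κ` with `κ⁻¹θ = θ'`; then `p(gθ′) = λ̄_θ(κ̄ ḡ⁻¹)` and `p(θ′) = λ̄_θ(κ̄)`
    obtain ⟨κ, hκ⟩ := exists_ringEquiv_smul_eq_emb θ' θ
    have hθ' : κ⁻¹ • θ = θ' := inv_smul_eq_iff.mpr hκ.symm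
    have h1 := h (CMNumbers.galRestrict κ) (CMNumbers.galRestrict g)⁻¹ (inv_mem hg)
    rw [← map_inv, ← map_mul, Λ.mtCharCM_galRestrict hpol, Λ.mtCharCM_galRestrict hpol, mtChar_apply, mtChar_apply, mul_inv_rev,
      inv_inv, mul_smul, hθ'] at h1
    exact h1
  · intro h
    refine ⟨Λ.mtCharCM_mem_infinityTypesCM hpol θ, fun σ ν hν => ?_⟩
    obtain ⟨g, rfl⟩ := CMNumbers.galRestrict_surjective σ
    obtain ⟨κ, rfl⟩ := CMNumbers.galRestrict_surjective ν
    rw [← map_mul, Λ.mtCharCM_galRestrict hpol, Λ.mtCharCM_galRestrict hpol, mtChar_apply, mtChar_apply, mul_inv_rev, mul_smul]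
    exact h κ⁻¹ (by rw [map_inv]; exact inv_mem hν) _

/-- The condition does not depend on `θ`: **`λ̄_θ ∈ Λ^E ⟺ λ̄_{θ′} ∈ Λ^E`.** [cite: MilneShih1982Taniyama, III §1 (1.6) (p. 232)] -/
theorem mtCharCM_mem_lambdaLevel_iff_of (hpol : (ofOrientation Λ).IsPolarizable) (θ θ' : K →+* ℂ) (E : IntermediateField ℚ cmNumbers) :
    Λ.mtCharCM θ ∈ lambdaLevel E ↔ Λ.mtCharCM θ' ∈ lambdaLevel E :=
  (Λ.mtCharCM_mem_lambdaLevel_iff hpol θ E).trans (Λ.mtCharCM_mem_lambdaLevel_iff hpol θ' E).symm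

/-- **`X^*(T^λ) = galSpan(λ̄_{θ₁}) ⊆ X^*(S^E)` — `MT(V_Π) = T^λ` is a quotient of the finite level `S^E` — iff `Aut(ℂ/E)` stabilises the type
of `Π`** (then g32-#10's `ρ^E_Π : S^E(ℂ) ↠ MT(V_Π)(ℂ)` is available). [cite: MilneShih1982Taniyama, III §1 (1.3) (p. 231), (1.6) (p. 232) («λ ∈ X^*(S^L) … T^λ the quotient of S^L»)] -/
theorem galSpan_mtCharCM_le_lambdaLevel_iff (hpol : (ofOrientation Λ).IsPolarizable) (θ₁ : K →+* ℂ) (E : IntermediateField ℚ cmNumbers) :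
    galSpan (Λ.mtCharCM θ₁) ≤ lambdaLevel E ↔
      ∀ g : ℂ ≃+* ℂ, CMNumbers.galRestrict g ∈ E.fixingSubgroup → ∀ θ' : K →+* ℂ, Λ.deg (g • θ') = Λ.deg θ' :=
  ⟨fun h => (Λ.mtCharCM_mem_lambdaLevel_iff hpol θ₁ E).mp (h (Λ.mtCharCM_mem_galSpan hpol θ₁ θ₁)),
    fun h => galSpan_le_lambdaLevel E ((Λ.mtCharCM_mem_lambdaLevel_iff hpol θ₁ E).mpr h)⟩

/-! ### §2 CM types: `λ̄ ∈ Λ^E` iff `Aut(ℂ/E)` fixes `μ_Φ` iff `E ⊇ E*(F,Φ)` -/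

omit [NumberField K] Λ in
/-- For the weight-one orientation `Π(Φ)` of a CM type, **stabilising the type is `gΦ = Φ`**: `p_{Π(Φ)}(gθ′) = p_{Π(Φ)}(θ′)` for all `θ′` iff
`g • χ ∈ Φ ⟺ χ ∈ Φ` for all `χ`. [cite: MilneCM2006, Ch. I §1 Prop. 1.16, Def. 1.17] [cite: Shimura1998, §8.3 Prop. 28] -/
theorem forall_deg_ofCMType_smul_eq_iff (Φ : CMType K) (g : ℂ ≃+* ℂ) :
    (∀ θ' : K →+* ℂ, (Orientation.ofCMType Φ).deg (g • θ') = (Orientation.ofCMType Φ).deg θ') ↔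
      ∀ χ : K →+* ℂ, g • χ ∈ Φ.1 ↔ χ ∈ Φ.1 := by
  refine forall_congr' fun χ => ?_
  by_cases h1 : g • χ ∈ Φ.1 <;> by_cases h2 : χ ∈ Φ.1 <;>
    simp only [h1, h2, ofCMType_deg_of_mem, ofCMType_deg_of_not_mem, not_false_eq_true, iff_true, iff_false,
      one_ne_zero, zero_ne_one, not_true_eq_false]

omit Λ in
/-- **`λ̄^{Φ}_θ ∈ Λ^E = X^*(S^E)` iff `Aut(ℂ/E)` FIXES THE HODGE COCHARACTER `μ_Φ`** (`(g ⊗ 1) ∘ μ_Φ(z) = μ_Φ(gz) ∘ (g ⊗ 1)` for all `g` over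
`E`): Milne–Shih's «`T` split over `L`, `μ` … defined over `L`» for `T = MT(V¹_{(F,Φ)})`, `μ = μ_Φ` (pub-hodgecm2's field-of-definition
criterion `forall_rTensor_aut_hodgeCocharacter_ofCMType_eq_iff_forall_smul_mem_iff`). [cite: MilneShih1982Taniyama, III §1 (1.3) (p. 231), (1.5)–(1.6) (p. 232)]
[cite: CattaniElZeinGriffithsLe2014, Ch. 12 (M. Kerr) §12.5.A Examples 12.5.2 (a)] -/
theorem mtCharCM_ofCMType_mem_lambdaLevel_iff_forall_rTensor_aut_hodgeCocharacter [HodgeTensorFacts.{0, 0}] (Φ : CMType K)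
    (hpol : (ofOrientation (Orientation.ofCMType Φ)).IsPolarizable) (θ : K →+* ℂ) (E : IntermediateField ℚ cmNumbers) :
    (Orientation.ofCMType Φ).mtCharCM θ ∈ lambdaLevel E ↔
      ∀ g : ℂ ≃+* ℂ, CMNumbers.galRestrict g ∈ E.fixingSubgroup → ∀ (z : ℂˣ) (x : ℂ ⊗[ℚ] K),
        (g.toRingHom.toRatAlgHom.toLinearMap.rTensor K) ((HodgeStructure.ofCMType Φ).hodgeCocharacter z x) =
          (HodgeStructure.ofCMType Φ).hodgeCocharacter (Units.map (g : ℂ →* ℂ) z)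
            ((g.toRingHom.toRatAlgHom.toLinearMap.rTensor K) x) :=
  ((Orientation.ofCMType Φ).mtCharCM_mem_lambdaLevel_iff hpol θ E).trans
    (forall_congr' fun g => forall_congr' fun _ =>
      (forall_deg_ofCMType_smul_eq_iff Φ g).trans (forall_rTensor_aut_hodgeCocharacter_ofCMType_eq_iff_forall_smul_mem_iff Φ g).symm)

omit Λ in
/-- `E ⊂ ℚ^{cm}` viewed in `ℂ` is countable. [folklore] -/
private theorem cardinalMk_lift_le_aleph0 (E : IntermediateField ℚ cmNumbers) : #(IntermediateField.lift E).toSubfield ≤ ℵ₀ :=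
  (Cardinal.mk_le_mk_of_subset (show ((IntermediateField.lift E).toSubfield : Set ℂ) ⊆ (cmNumbers : Set ℂ) from
    fun _ hx => IntermediateField.lift_le E hx)).trans cardinalMk_cmNumbers_le_aleph0

omit Λ in
/-- **`λ̄^{Φ}_θ ∈ Λ^E = X^*(S^E)` iff `E ⊇ E*(F,Φ)`**, the reflex field (Shimura's `ℚ(tr_Φ(ξ)) ⊂ ℂ`, the tree's `traceField Φ`): `Aut(ℂ/E)`
stabilises `Φ` iff it fixes `E*` pointwise (Prop. 28), iff `E* ⊆ E` (the fixed field of `Aut(ℂ/E)` is `E`).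
[cite: MilneShih1982Taniyama, III §1 (1.3) (p. 231), (1.6) (p. 232)] [cite: MilneCM2006, Ch. I §1 Prop. 1.16, Def. 1.17, Prop. 1.18] [cite: Shimura1998, §8.3 Prop. 28] -/
theorem mtCharCM_ofCMType_mem_lambdaLevel_iff_traceField_le (Φ : CMType K) (hpol : (ofOrientation (Orientation.ofCMType Φ)).IsPolarizable)
    (θ : K →+* ℂ) (E : IntermediateField ℚ cmNumbers) :
    (Orientation.ofCMType Φ).mtCharCM θ ∈ lambdaLevel E ↔ traceField Φ ≤ IntermediateField.lift E := by
  rw [(Orientation.ofCMType Φ).mtCharCM_mem_lambdaLevel_iff hpol θ E]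
  constructor
  · intro h c hc
    refine Literature.FieldTheory.AlgClosed.Complex.mem_subfield_of_forall_ringEquiv (IntermediateField.lift E).toSubfield
      (cardinalMk_lift_le_aleph0 E)
      fun g hg => ?_
    exact (forall_smul_mem_iff_iff_forall_apply_traceField_eq g Φ).mp ((forall_deg_ofCMType_smul_eq_iff Φ g).mp
      (h g ((galRestrict_mem_fixingSubgroup_iff g E).mpr hg))) c hc
  · intro hle g hg
    exact (forall_deg_ofCMType_smul_eq_iff Φ g).mpr ((forall_smul_mem_iff_iff_forall_apply_traceField_eq g Φ).mpr
      fun c hc => (galRestrict_mem_fixingSubgroup_iff g E).mp hg c (hle hc))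

omit Λ in
/-- **`MT(V¹_{(F,Φ)}) = T^λ` IS A QUOTIENT OF THE FINITE LEVEL `S^E` iff `E ⊇ E*(F,Φ)`**: `X^*(T^λ) = galSpan(λ̄_{θ₁}) ⊆ X^*(S^E) = Λ^E ⟺
traceField Φ ⊆ E` — the levels through which `ρ_{Π(Φ)}` factors (g32-#10 `serreToGLLevel`) are exactly those containing the reflex field.
[cite: MilneShih1982Taniyama, III §1 (1.3) (p. 231), (1.6) (p. 232)] [cite: MilneCM2006, Ch. I §1 Def. 1.17, §4 Prop. 4.21] [cite: Shimura1998, §8.3 Prop. 28] -/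
theorem galSpan_mtCharCM_ofCMType_le_lambdaLevel_iff_traceField_le (Φ : CMType K)
    (hpol : (ofOrientation (Orientation.ofCMType Φ)).IsPolarizable) (θ₁ : K →+* ℂ) (E : IntermediateField ℚ cmNumbers) :
    galSpan ((Orientation.ofCMType Φ).mtCharCM θ₁) ≤ lambdaLevel E ↔ traceField Φ ≤ IntermediateField.lift E :=
  ((Orientation.ofCMType Φ).galSpan_mtCharCM_le_lambdaLevel_iff hpol θ₁ E).trans
    (((Orientation.ofCMType Φ).mtCharCM_mem_lambdaLevel_iff hpol θ₁ E).symm.trans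
      (mtCharCM_ofCMType_mem_lambdaLevel_iff_traceField_le Φ hpol θ₁ E))

omit Λ in
/-- Hence **for every level `E ⊇ E*(F,Φ)` the Mumford–Tate homomorphism of `V¹_{(F,Φ)}` factors through `S^E`**: g32-#10's
`ρ^E_{Π(Φ)} : S^E(ℂ) → GL(V_ℂ)` with `ρ^E ∘ (S ↠ S^E) = ρ_{Π(Φ)}`, image `MT(ℂ)`, and `ρ^E ∘ μ^E = μ_{Π(Φ)}`.
[cite: MilneShih1982Taniyama, III §1 (1.3) (p. 231), (1.6) (p. 232)] [cite: MilneCM2006, Ch. I §4 Prop. 4.21] -/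
theorem exists_serreToGLLevel_of_traceField_le [HodgeTensorFacts.{0, 0}] (Φ : CMType K)
    (hpol : (ofOrientation (Orientation.ofCMType Φ)).IsPolarizable) (θ₁ : K →+* ℂ) (E : IntermediateField ℚ cmNumbers)
    (hE : traceField Φ ≤ IntermediateField.lift E) :
    ∃ ρE : serreLevelPoints ℂ E →* ((ℂ ⊗[ℚ] K) ≃ₗ[ℂ] (ℂ ⊗[ℚ] K)),
      ρE.comp (toLevel ℂ E) = (Orientation.ofCMType Φ).serreToGL hpol ∧
        ρE.range = (ofOrientation (Orientation.ofCMType Φ)).mumfordTateGroupBaseChange ℂ ∧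
          ∀ z : ℂˣ, ρE (muLevelPoints ℂ E z) = (ofOrientation (Orientation.ofCMType Φ)).hodgeCocharacter z :=
  have hmem : (Orientation.ofCMType Φ).mtCharCM θ₁ ∈ lambdaLevel E :=
    (mtCharCM_ofCMType_mem_lambdaLevel_iff_traceField_le Φ hpol θ₁ E).mpr hE
  ⟨(Orientation.ofCMType Φ).serreToGLLevel hpol θ₁ E hmem, (Orientation.ofCMType Φ).serreToGLLevel_comp_toLevel hpol θ₁ E hmem,
    (Orientation.ofCMType Φ).range_serreToGLLevel hpol θ₁ E hmem, (Orientation.ofCMType Φ).serreToGLLevel_muLevelPoints hpol θ₁ E hmem⟩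

end Orientation

end HodgeStructure

end Literature.AlgebraicGeometry.Motives
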